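import Literature.AnabelianGeometry.EtaleTheta.SettingModelTateInversionTheta
import Literature.AnabelianGeometry.EtaleTheta.SettingModelTateKummerData
import Literature.AnabelianGeometry.EtaleTheta.SettingModelTateDeckLevels
import Literature.AnabelianGeometry.EtaleTheta.KummerDataOfCoreSection
import Literature.AnabelianGeometry.EtaleTheta.EtaleThetaDataOfClass
import HarnessLib

/-!
# The STAGE-2 model: [EtTh] Prop. 1.5 (iii) inversion clauses `InvClauses` for the section data carrying `η̈♯ = etaDdχq`
# — `ι` fixes `η̈^Θ + log(O^×_K̈)` (all `i, j`) and sends `log(Ü)` to `−log(Ü)` exactly when `j = 2i` (proof-only)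

Mochizuki, *The étale theta function …*, Publ. RIMS **45** (2009) [EtTh], Prop. 1.5 (iii) p. 23: «any inversion
automorphism ι … fixes η̈^Θ + log(O^×_K̈), but maps log(Ü) + log(O^×_K̈) to −log(Ü) + log(O^×_K̈)»
[cite: MochizukiEtTh2009, Prop 1.5 (iii) p.23].  abc-iut cell, layer L2, prover abc-iut-L2-d1 (gen 5); PROOF-ONLY stage-2
twin of this seat's `SettingModelChiInvClauses`, over: abc-iut-L2-t5's `ThetaSetting.modelχq p i j hj`; abc-iut-w5-d249's
`inversionχq` with this seat's `isInversionAut_inversionχq` / `transport_etaDdχq` (`SettingModelTateInversionAut/Theta`);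
abc-iut-L6-d5's Kummer core `kummerCoreχq` (`log(Ü)` := the kit class of `c^{ŷ/2}`, `SettingModelTateKummerData`) and
the SECTION Kummer data `(kummerCoreχq …).toKummerDataOfSection s …` of ANY Galois section `s` (abc-iut-w5-d029's
`KummerDataOfCoreSection`) — the data of abc-iut-L2-t8's stage-2 capstone `E_s := K_s.etaleThetaDataOfClass (etaDdχq …)`.

* clause (a), ALL `i`, even `j`, every section `s`, every companion `cι`: `transportFun_inversionχq_eq_self_of_aug`
  (cocycles through `aug` are fixed: `ι` over `G_K`, `ι^Θ = id` on `Δ_Θ`), `transport_inflTheta_kumYdd_ofSection`,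
  `transport_eq_self_of_mem_kumUnitsYdd_ofSection`, **`image_thetaClasses_modelχq_ofSection`**;
* clause (b) WHEN `j = 2i` (the defect exponent `κ_p^{j−2i}` of `ι` is then `0`: `invDefect_tatePairHom_eq_one_of`):
  `yCoordχq_inversionχq_of` (`ŷ(ι g) = ŷ(g)⁻¹`), `transport_inflTheta_logUdd_kummerCoreχq_of` (`ι_* log(Ü) = −log(Ü)`),
  **`apply_logUdd_kummerCoreχq_eq_inv_of`** (every intertwiner `T`: `T log(Ü) = −log(Ü)`; abc-iut-L2-t12's `inflTheta_injective`);
* **`invClauses_modelχq_ofSection (h2 : −i + −i + j = 0)`** — `InvClauses E_s hι cι` for every section `s` and companion;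
  at the instance of record `(i, j) = (1, 2)` with `s := inr`: **`invClauses_modelTate_inr`**, NV
  `ThetaSetting.exists_isEtThOrigin_invClauses_stageTwo`.
REMARK (why `j = 2i`): for `j ≠ 2i` the Θ-transport of `log(Ü)` is `−log(Ü) + [σ ↦ c^{κ_p(σ)^{j−2i}/2}]`, the Kummer class
of the NON-unit `p^{(j−2i)/2}` — clause (b) then needs a non-unit; the deck-relation certificate `(i, j) = (1, 2)` is
exactly the defect-free case.  SEMI-SYNTHETIC MODEL, consistency evidence only; nothing of [EtTh] asserted; no side
taken on [IUTchIII] Cor. 3.12.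
-/

noncomputable section

namespace Literature.AnabelianGeometry.EtaleTheta.SettingModel

open Literature.AnabelianGeometry.SemiGraphs _root_.Function

variable (p : ℕ) [Fact p.Prime] (i j : ℤ) (hj : Even j)
  (cι : ThetaSetting.ThetaCompanion (Dα := ThetaSetting.modelχq p i j hj) (Dβ := ThetaSetting.modelχq p i j hj)
    (inversionχq p i j))

/-! ### Cocycles through `aug` are fixed by the transport (all `i`, even `j`) -/

/-- `aug (ι⁻¹ x) = aug x` (`ι` is over `G_K`). [cite: Mochizuki2012, Rmk 1.4.1 (ii) p.28] -/
theorem aug_inversionχq_symm (x : PiTpχq p i j) :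
    (ThetaSetting.modelχq p i j hj).aug ((inversionχq p i j).symm x) = (ThetaSetting.modelχq p i j hj).aug x := by
  rw [inversionχq_symm_apply]
  rfl

/-- **A cocycle on `Π^tp_Ÿ` factoring through `aug` is fixed by `ι^Θ ∘ f ∘ ι⁻¹`** (stage 2, every companion).
[cite: MochizukiEtTh2009, Thm 1.6 (iii) p.24] -/
theorem transportFun_inversionχq_eq_self_of_aug
    (f : ↥(ThetaSetting.modelχq p i j hj).GtpYdd → ↥(ThetaSetting.modelχq p i j hj).DeltaTheta)
    (hf : ∀ x y : ↥(ThetaSetting.modelχq p i j hj).GtpYdd,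
      (ThetaSetting.modelχq p i j hj).aug (x : PiTpχq p i j) = (ThetaSetting.modelχq p i j hj).aug (y : PiTpχq p i j) →
        f x = f y) :
    ThetaSetting.transportFun cι (isInversionAut_inversionχq p i j hj).thm16i f = f := by
  funext x
  apply Subtype.ext
  change cι.thetaIso (f ⟨(inversionχq p i j).symm (x : PiTpχq p i j), _⟩).1 = (f x).1
  rw [thetaIso_inversionχq_apply_eq_self p i j hj cι (f _).2]
  exact congrArg Subtype.val (hf _ _ (aug_inversionχq_symm p i j hj x))

section SectionDatum

variable (s : GQp p →* PiTpχq p i j) (hs : Continuous s)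
  (hsec : ∀ σ : GQp p, (ThetaSetting.modelχq p i j hj).aug (s σ) = σ)
  (hsY : (ThetaSetting.modelχq p i j hj).GK.map s ≤ (ThetaSetting.modelχq p i j hj).GtpY)
  (hsYdd : (ThetaSetting.modelχq p i j hj).GKdd.map s ≤ (ThetaSetting.modelχq p i j hj).GtpYdd)

/-- **`ι` fixes every Kummer class of the section datum of `s`**: the inflated Kummer cocycle is `g ↦ f(aug g)`.
[cite: MochizukiEtTh2009, Prop 1.5 (iii) p.23] -/
theorem transport_inflTheta_kumYdd_ofSection
    (k : ((kummerCoreχq p i j hj).toKummerDataOfSection s hs hsec hsY hsYdd).KddHat) :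
    ThetaSetting.transport cι (isInversionAut_inversionχq p i j hj).thm16i
        ((ThetaSetting.modelχq p i j hj).inflTheta (ThetaSetting.modelχq p i j hj).GtpYdd
          (((kummerCoreχq p i j hj).toKummerDataOfSection s hs hsec hsY hsYdd).kumYdd k)) =
      (ThetaSetting.modelχq p i j hj).inflTheta (ThetaSetting.modelχq p i j hj).GtpYdd
        (((kummerCoreχq p i j hj).toKummerDataOfSection s hs hsec hsY hsYdd).kumYdd k) := by
  induction k using QuotientGroup.induction_on with
  | H f =>
    change ContH1.mk _ _ = ContH1.mk _ _
    refine ContH1.mk_congr _ (transportFun_inversionχq_eq_self_of_aug p i j hj cι _ fun x y hxy => ?_) _ _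
    change f.1 ⟨(kummerCoreχq p i j hj).augTheta ((ThetaSetting.modelχq p i j hj).toTheta (x : PiTpχq p i j)), _⟩ =
      f.1 ⟨(kummerCoreχq p i j hj).augTheta ((ThetaSetting.modelχq p i j hj).toTheta (y : PiTpχq p i j)), _⟩
    exact congrArg f.1 (Subtype.ext (by
      change (kummerCoreχq p i j hj).augTheta _ = (kummerCoreχq p i j hj).augTheta _
      rw [(kummerCoreχq p i j hj).augTheta_toTheta, (kummerCoreχq p i j hj).augTheta_toTheta]
      exact hxy))

/-- **`ι` fixes `log(O^×_K̈)`** of the section datum of `s`. [cite: MochizukiEtTh2009, Prop 1.5 (iii) p.23] -/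
theorem transport_eq_self_of_mem_kumUnitsYdd_ofSection
    {k : (ThetaSetting.modelχq p i j hj).H1 (ThetaSetting.modelχq p i j hj).GtpYdd}
    (hk : k ∈ ((kummerCoreχq p i j hj).toKummerDataOfSection s hs hsec hsY hsYdd).kumUnitsYdd) :
    ThetaSetting.transport cι (isInversionAut_inversionχq p i j hj).thm16i k = k := by
  obtain ⟨c, -, rfl⟩ := hk
  exact transport_inflTheta_kumYdd_ofSection p i j hj cι s hs hsec hsY hsYdd c

/-- **Prop. 1.5 (iii) clause (a) at the stage-2 model** (all `i`, even `j`, every section `s`, every companion): the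
transport along `ι` maps the étale theta classes `O^×_K̈ · η̈♯` of `E_s` onto themselves (pointwise fixed).
[cite: MochizukiEtTh2009, Prop 1.5 (iii) p.23] -/
theorem image_thetaClasses_modelχq_ofSection :
    ThetaSetting.transport cι (isInversionAut_inversionχq p i j hj).thm16i ''
        (((kummerCoreχq p i j hj).toKummerDataOfSection s hs hsec hsY hsYdd).etaleThetaDataOfClass
          (etaDdχq p i j hj)).thetaClasses =
      (((kummerCoreχq p i j hj).toKummerDataOfSection s hs hsec hsY hsYdd).etaleThetaDataOfClass
        (etaDdχq p i j hj)).thetaClasses := by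
  have hfix : ∀ x ∈ (((kummerCoreχq p i j hj).toKummerDataOfSection s hs hsec hsY hsYdd).etaleThetaDataOfClass
      (etaDdχq p i j hj)).thetaClasses,
      ThetaSetting.transport cι (isInversionAut_inversionχq p i j hj).thm16i x = x := by
    rintro x ⟨k, hk, rfl⟩
    rw [map_mul, transport_eq_self_of_mem_kumUnitsYdd_ofSection p i j hj cι s hs hsec hsY hsYdd hk]
    exact congrArg (k * ·) (transport_etaDdχq p i j hj cι)
  ext x
  constructor
  · rintro ⟨y, hy, rfl⟩
    rw [hfix y hy]
    exact hy
  · intro hx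
    exact ⟨x, hx, hfix x hx⟩

end SectionDatum

/-! ### Clause (b) when `j = 2i`: `ι` has no defect and negates `ŷ` -/

/-- For `j = 2i` the defect exponent of the stage-2 inversion vanishes: `κ_p(σ)^{j−2i} = κ_p(σ)^0`.
[cite: Mochizuki2012, Rmk 1.4.1 (ii) p.28] -/
theorem invDefect_tatePairHom_eq_one_of (h2 : -i + -i + j = 0) (σ : GQp p) : invDefect (tatePairHom p i j σ) = 1 := by
  rw [invDefect_tatePairHom, h2, zpow_zero]

/-- **`ŷ(ι g) = ŷ(g)⁻¹` when `j = 2i`.** [cite: MochizukiEtTh2009, Prop 1.5 (iii) p.23] -/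
theorem yCoordχq_inversionχq_of (h2 : -i + -i + j = 0) (g : PiTpχq p i j) :
    yCoordχq p i j (inversionχq p i j g) = (yCoordχq p i j g)⁻¹ := by
  rw [yCoordχq_inversionχq, invDefect_tatePairHom_eq_one_of p i j h2, mul_one]

/-- `ŷ(ι⁻¹ x)^Θ = (ŷ(x)^Θ)⁻¹` when `j = 2i`. [cite: MochizukiEtTh2009, Prop 1.5 (iii) p.23] -/
theorem yThetaχq_toTheta_inversionχq_symm_of (h2 : -i + -i + j = 0) (x : PiTpχq p i j) :
    yThetaχq p i j ((ThetaSetting.modelχq p i j hj).toTheta ((inversionχq p i j).symm x)) =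
      (yThetaχq p i j ((ThetaSetting.modelχq p i j hj).toTheta x))⁻¹ := by
  rw [inversionχq_symm_apply]
  exact yCoordχq_inversionχq_of p i j h2 x

/-- **The kit's `log(Ü)`-cocycle `c^{ŷ/2}` at `ι⁻¹ x` is the inverse of its value at `x`** (`j = 2i`).
[cite: MochizukiEtTh2009, Prop 1.5 (iii) p.23] -/
theorem logUddFun_yCoordKitχq_inversionχq_symm_of (h2 : -i + -i + j = 0) (x : ↥(ThetaSetting.modelχq p i j hj).GtpYdd) :
    (yCoordKitχq p i j hj).logUddFun
        ⟨(ThetaSetting.modelχq p i j hj).toTheta ((inversionχq p i j).toMulEquiv.symm (x : PiTpχq p i j)),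
          ⟨_, ThetaSetting.symm_mem_GtpYdd (isInversionAut_inversionχq p i j hj).thm16i x, rfl⟩⟩ =
      ((yCoordKitχq p i j hj).logUddFun
        ⟨(ThetaSetting.modelχq p i j hj).toTheta (x : PiTpχq p i j), ⟨x.1, x.2, rfl⟩⟩)⁻¹ := by
  unfold ThetaSetting.YCoordKit.logUddFun
  rw [← map_inv, ← map_inv]
  refine congrArg (fun t : ↥sqHom.range => (yCoordKitχq p i j hj).iota (half t)) (Subtype.ext ?_)
  exact yThetaχq_toTheta_inversionχq_symm_of p i j hj h2 x

/-- **`ι_* log(Ü) = −log(Ü)` on `Π^tp_Ÿ` at the stage-2 model when `j = 2i`** (every companion).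
[cite: MochizukiEtTh2009, Prop 1.5 (iii) p.23] -/
theorem transport_inflTheta_logUdd_kummerCoreχq_of (h2 : -i + -i + j = 0) :
    ThetaSetting.transport cι (isInversionAut_inversionχq p i j hj).thm16i
        ((ThetaSetting.modelχq p i j hj).inflTheta (ThetaSetting.modelχq p i j hj).GtpYdd
          (kummerCoreχq p i j hj).logUdd) =
      ((ThetaSetting.modelχq p i j hj).inflTheta (ThetaSetting.modelχq p i j hj).GtpYdd
        (kummerCoreχq p i j hj).logUdd)⁻¹ := by
  rw [eq_inv_iff_mul_eq_one]
  change ContH1.mk _ _ * ContH1.mk _ _ = 1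
  rw [ContH1.mk_mul_mk, ← ContH1.mk_one]
  refine ContH1.mk_congr _ (funext fun x => ?_) _ _
  rw [Pi.mul_apply, Pi.one_apply, mul_eq_one_iff_eq_inv]
  apply Subtype.ext
  change cι.thetaIso ((yCoordKitχq p i j hj).logUddFun ⟨(ThetaSetting.modelχq p i j hj).toTheta
      ((inversionχq p i j).toMulEquiv.symm (x : PiTpχq p i j)), _⟩).1 =
    (((yCoordKitχq p i j hj).logUddFun ⟨(ThetaSetting.modelχq p i j hj).toTheta (x : PiTpχq p i j), _⟩)⁻¹).1
  rw [thetaIso_inversionχq_apply_eq_self p i j hj cι ((yCoordKitχq p i j hj).logUddFun _).2]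
  exact congrArg Subtype.val (logUddFun_yCoordKitχq_inversionχq_symm_of p i j hj h2 x)

/-- **Prop. 1.5 (iii) clause (b) at the stage-2 model when `j = 2i`, with `u := 1`**: every automorphism `T` of
`H¹((Π^tp_Ÿ)^Θ, Δ_Θ)` intertwining the transport along `ι` sends `log(Ü)` to `−log(Ü)` (abc-iut-L2-t12's
`inflTheta_injective`). [cite: MochizukiEtTh2009, Prop 1.5 (iii) p.23] -/
theorem apply_logUdd_kummerCoreχq_eq_inv_of (h2 : -i + -i + j = 0)
    (T : (ThetaSetting.modelχq p i j hj).H1Theta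
        ((ThetaSetting.modelχq p i j hj).GtpYdd.map (ThetaSetting.modelχq p i j hj).toTheta) ≃*
      (ThetaSetting.modelχq p i j hj).H1Theta
        ((ThetaSetting.modelχq p i j hj).GtpYdd.map (ThetaSetting.modelχq p i j hj).toTheta))
    (hT : ∀ z, (ThetaSetting.modelχq p i j hj).inflTheta (ThetaSetting.modelχq p i j hj).GtpYdd (T z) =
      ThetaSetting.transport cι (isInversionAut_inversionχq p i j hj).thm16i
        ((ThetaSetting.modelχq p i j hj).inflTheta (ThetaSetting.modelχq p i j hj).GtpYdd z)) :
    T (kummerCoreχq p i j hj).logUdd = ((kummerCoreχq p i j hj).logUdd)⁻¹ := by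
  apply (ThetaSetting.modelχq p i j hj).inflTheta_injective (ThetaSetting.modelχq p i j hj).GtpYdd
  rw [hT, map_inv, transport_inflTheta_logUdd_kummerCoreχq_of p i j hj cι h2]

/-! ### `InvClauses` at the stage-2 model -/

section SectionDatum

variable (s : GQp p →* PiTpχq p i j) (hs : Continuous s)
  (hsec : ∀ σ : GQp p, (ThetaSetting.modelχq p i j hj).aug (s σ) = σ)
  (hsY : (ThetaSetting.modelχq p i j hj).GK.map s ≤ (ThetaSetting.modelχq p i j hj).GtpY)
  (hsYdd : (ThetaSetting.modelχq p i j hj).GKdd.map s ≤ (ThetaSetting.modelχq p i j hj).GtpYdd)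

/-- **[EtTh] Prop. 1.5 (iii), inversion clauses, WITNESSED at the stage-2 model for `j = 2i`**: for the section
datum of ANY Galois section `s` with the class of record `η̈♯ = etaDdχq`, the cocycle-corrected inversion and EVERY theta
companion of it, `InvClauses` holds — `ι` fixes `η̈^Θ + log(O^×_K̈)` and sends `log(Ü)` to `−log(Ü)` (`u := 1`).
[cite: MochizukiEtTh2009, Prop 1.5 (iii) p.23] -/
theorem invClauses_modelχq_ofSection (h2 : -i + -i + j = 0) :
    ThetaSetting.InvClauses
      (((kummerCoreχq p i j hj).toKummerDataOfSection s hs hsec hsY hsYdd).etaleThetaDataOfClass (etaDdχq p i j hj))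
      (isInversionAut_inversionχq p i j hj) cι where
  image_thetaClasses := image_thetaClasses_modelχq_ofSection p i j hj cι s hs hsec hsY hsYdd
  logUdd_inv T hT := ⟨1, Subgroup.one_mem _, by
    rw [map_one, map_one, mul_one]
    exact apply_logUdd_kummerCoreχq_eq_inv_of p i j hj cι h2 T hT⟩

end SectionDatum

/-! ### The instance of record: `(i, j) = (1, 2)`, `s := inr` -/

/-- **`InvClauses` at the instance of record**: `modelχq p 1 2` (the Tate shear, `κ(q_X) = 2κ_p`, defect-free inversion),
section datum of the Galois factor `inr` (section hypotheses discharged inline, verbatim as in abc-iut-L2-t6's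
`prop15iii_etaleThetaDataOfClass_etaDdχq_inr`, so this is the SAME `E`), class `η̈♯ = etaDdχq`, every theta companion.
[cite: MochizukiEtTh2009, Prop 1.5 (iii) p.23] -/
theorem invClauses_modelTate_inr
    (cι : ThetaSetting.ThetaCompanion (Dα := ThetaSetting.modelχq p 1 2 even_two)
      (Dβ := ThetaSetting.modelχq p 1 2 even_two) (inversionχq p 1 2)) :
    ThetaSetting.InvClauses
      (((kummerCoreχq p 1 2 even_two).toKummerDataOfSection (SemidirectProduct.inr : GQp p →* PiTpχq p 1 2)
        (continuous_inrχq p 1 2) (fun _ => rfl)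
        (by
          rintro _ ⟨σ, -, rfl⟩
          show (tateTwistData₀ p 1 2).toZ _ = 1
          rw [GfpTwistData₀.toZ_apply, SemidirectProduct.left_inr, map_one])
        (by
          rintro _ ⟨σ, -, rfl⟩
          refine mem_GtpYdd_modelχq_of_hHat_two_y p 1 2 even_two ?_ ?_
          · show (tateTwistData₀ p 1 2).toZ _ = 1
            rw [GfpTwistData₀.toZ_apply, SemidirectProduct.left_inr, map_one]
          · rw [SemidirectProduct.left_inr, map_one, map_one, Heis.one_y])).etaleThetaDataOfClass
        (etaDdχq p 1 2 even_two))
      (isInversionAut_inversionχq p 1 2 even_two) cι :=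
  invClauses_modelχq_ofSection p 1 2 even_two cι _ _ _ _ _ (by norm_num)

/-- **Census form (NV, stage 2)**: at the stage-2 model of record there are an inversion automorphism (Prop. 1.5 (iii)),
a theta companion, and étale theta data carrying the class of record `η̈♯ = etaDdχq` for which `InvClauses` holds.
[cite: MochizukiEtTh2009, Prop 1.5 (iii) p.23] -/
theorem _root_.Literature.AnabelianGeometry.EtaleTheta.ThetaSetting.exists_isEtThOrigin_invClauses_stageTwo :
    ∃ (D : ThetaSetting p) (ι : D.PiTemp ≃ₜ* D.PiTemp) (hι : D.IsInversionAut ι) (cι : ThetaSetting.ThetaCompanion ι)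
      (E : D.EtaleThetaData), D = ThetaSetting.modelχq p 1 2 even_two ∧ D.IsEtThOrigin ∧ ThetaSetting.InvClauses E hι cι :=
  ⟨ThetaSetting.modelχq p 1 2 even_two, inversionχq p 1 2, isInversionAut_inversionχq p 1 2 even_two,
    (nonempty_thetaCompanion_inversionχq p 1 2 even_two).some, _, rfl, ThetaSetting.modelχq_isEtThOrigin p 1 2 even_two,
    invClauses_modelTate_inr p _⟩

end Literature.AnabelianGeometry.EtaleTheta.SettingModel

end
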